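import Mathlib
import HarnessLib
import Summits.NavierStokesRegularity.NavierStokesRegularity.Theses.SymmetryModuliCount
import Literature.Analysis.FluidPDE.VectorCalculus
import Literature.Analysis.FluidPDE.Vorticity

/-!
# Sketch — crux-ideate stmt-NavierStokesRegularity-4054 (LinearLiouvilleSeven), ideator 1, round 1

First lemmas of the idea cards `idea-galilean-collapse.md` and `idea-vortex-stretching-wall.md`,
stated as `Prop`s over existing declarations (no proofs at this stage; everything must elaborate).
Cards: `idea-galilean-collapse.md`, `idea-vortex-stretching-wall.md`, `idea-backward-profile-symmetrisation.md`.
-/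

namespace Summit.NavierStokesRegularity.NavierStokesRegularity.Cruxes.LinearLiouvilleSeven.Ideator1

open scoped InnerProductSpace
open Literature.Analysis.FluidPDE

local notation "ℝ³" => EuclideanSpace ℝ (Fin 3)

/-- The class `𝒜_C` of the route, verbatim (smooth on `t<0`, div-free, KNSS-mild Oseen equation,
Type-I time decay). -/
def InClassA (C : ℝ) (u : ℝ → ℝ³ → ℝ³) : Prop :=
  ContDiffOn ℝ (⊤ : ℕ∞) (Function.uncurry u) (Set.Iio 0 ×ˢ Set.univ) ∧
  (∀ t < 0, VectorCalculus.IsDivFree (u t)) ∧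
  (∀ s t : ℝ, s < t → t < 0 → ∀ x, u t x = heatFlow (u s) (t - s) x -
      ∫ τ in Set.Ioo s t, ∫ y, oseenKernel (t - τ) (x - y) (u τ y) (u τ y)) ∧
  HasTypeITimeDecay C u

/-- Tempered classical solution `(v,q)` of the linearised system around `u`, verbatim the crux's
clause for one index `i`. -/
def IsTemperedLinearised (u v : ℝ → ℝ³ → ℝ³) (q : ℝ → ℝ³ → ℝ) : Prop :=
  ContDiffOn ℝ (⊤ : ℕ∞) (Function.uncurry v) (Set.Iio 0 ×ˢ Set.univ) ∧
  ContDiffOn ℝ (⊤ : ℕ∞) (Function.uncurry q) (Set.Iio 0 ×ˢ Set.univ) ∧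
  (∃ K : ℝ, ∀ t < 0, ∀ x, ‖v t x‖ ≤ K / Real.sqrt (-t) + K * (1 + ‖x‖) / (-t) ∧
      |q t x| ≤ K / (-t) + K * (1 + ‖x‖) / Real.sqrt (-t) ^ 3) ∧
  (∀ t < 0, VectorCalculus.IsDivFree (v t)) ∧
  (∀ t < 0, ∀ x, timeDeriv v t x + convect (u t) (v t) x + convect (v t) (u t) x =
      Laplacian.laplacian (v t) x - gradient (q t) x)

/-! ## Card `galilean-collapse` -/

/-- GAUGE BOUNDS (support-level input, KNSS2009 Prop 4.1 / Seregin2014Notes Prop 3.9 type; the same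
inputs as the route's support item `JacobiFieldsTempered`): an element of `𝒜_C` is a classical solution
of the differential Navier–Stokes system for a smooth pressure `p` with the scale-invariant bounds
`|∇u| ≤ C₁/(−t)`, `|∇p| ≤ C₃ (−t)^{-3/2}`. -/
def GaugeBounds : Prop :=
  ∀ (C : ℝ) (u : ℝ → ℝ³ → ℝ³), InClassA C u →
    ∃ (p : ℝ → ℝ³ → ℝ) (C₁ C₃ : ℝ),
      ContDiffOn ℝ (⊤ : ℕ∞) (Function.uncurry p) (Set.Iio 0 ×ˢ Set.univ) ∧
      (∀ t < 0, ∀ x, timeDeriv u t x + convect (u t) (u t) x =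
          Laplacian.laplacian (u t) x - gradient (p t) x) ∧
      (∀ t < 0, ∀ x, ‖fderiv ℝ (u t) x‖ ≤ C₁ / (-t)) ∧
      (∀ t < 0, ∀ x, ‖gradient (p t) x‖ ≤ C₃ / Real.sqrt (-t) ^ 3)

/-- FIRST LEMMA (a), the Galilean Jacobi identity: for a classical NS pair `(u,p)` on `t<0` and a
`C²`-in-time translation `β`, the infinitesimal generalised-Galilean field
`v_β = β'(t) − (β(t)·∇)u`, `q_β = −β''(t)·x − (β(t)·∇)p` solves the linearised DIFFERENTIAL system
(Lemarié-Rieusset 2016 §10.1 p.270, Boisvert's generalised symmetry, differentiated at `β = 0`). -/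
def GalileanJacobiIdentity : Prop :=
  ∀ (u : ℝ → ℝ³ → ℝ³) (p : ℝ → ℝ³ → ℝ) (β : ℝ → ℝ³),
    ContDiffOn ℝ (⊤ : ℕ∞) (Function.uncurry u) (Set.Iio 0 ×ˢ Set.univ) →
    ContDiffOn ℝ (⊤ : ℕ∞) (Function.uncurry p) (Set.Iio 0 ×ˢ Set.univ) →
    ContDiff ℝ (⊤ : ℕ∞) β →
    (∀ t < 0, VectorCalculus.IsDivFree (u t)) →
    (∀ t < 0, ∀ x, timeDeriv u t x + convect (u t) (u t) x =
        Laplacian.laplacian (u t) x - gradient (p t) x) →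
    let v : ℝ → ℝ³ → ℝ³ := fun t x => deriv β t - fderiv ℝ (u t) x (β t)
    let q : ℝ → ℝ³ → ℝ := fun t x => -⟪iteratedDeriv 2 β t, x⟫_ℝ - fderiv ℝ (p t) x (β t)
    (∀ t < 0, VectorCalculus.IsDivFree (v t)) ∧
    (∀ t < 0, ∀ x, timeDeriv v t x + convect (u t) (v t) x + convect (v t) (u t) x =
        Laplacian.laplacian (v t) x - gradient (q t) x)

/-- FIRST LEMMA (b), the collapse: given the gauge bounds, the crux `LinearLiouvilleSeven` already
implies the route's TARGET `TypeIAncientLiouville` (feed seven modulated Galilean fields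
`β_i = φ_i(t) e`, `φ_i(t) = cos (i · log (1 + √(−t)))`; the slice-constant combination forces
`∂_e u ≡ 0`; three directions give `∇u ≡ 0`, the Oseen gauge and Type-I decay give `u ≡ 0`). -/
def GalileanCollapse : Prop :=
  GaugeBounds →
    Summit.NavierStokesRegularity.NavierStokesRegularity.Theses.SymmetryModuliCount.LinearLiouvilleSeven →
    Summit.NavierStokesRegularity.NavierStokesRegularity.Theses.SymmetryModuliCount.TypeIAncientLiouville

/-- FIRST LEMMA (c), the `u = 0` anchor (the only part of the crux provable without proving X):
tempered classical solutions of the STOKES system on `(−∞,0)×ℝ³` are slice-wise constant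
(`Δq = 0` ⇒ `q = α(t) + γ(t)·x`; `v + ∫γ` is caloric of linear growth and decays backward;
Tychonoff uniqueness). -/
def TemperedStokesLiouville : Prop :=
  ∀ (v : ℝ → ℝ³ → ℝ³) (q : ℝ → ℝ³ → ℝ), IsTemperedLinearised (fun _ _ => 0) v q →
    ∀ t < 0, ∃ b : ℝ³, ∀ x, v t x = b

/-- Sanity form of the anchor: X (the target) implies the crux outright, via (c). -/
def AnchorGivesCrux : Prop :=
  TemperedStokesLiouville →
    Summit.NavierStokesRegularity.NavierStokesRegularity.Theses.SymmetryModuliCount.TypeIAncientLiouville →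
    Summit.NavierStokesRegularity.NavierStokesRegularity.Theses.SymmetryModuliCount.LinearLiouvilleSeven

/-! ## Card `vortex-stretching-wall` -/

/-- FIRST LEMMA (wall lemma, closed form): an element of `𝒜_C` whose strain never stretches faster
than the self-similar rate — `(−t)·⟪∇u(t,x) e, e⟫ ≤ ‖e‖²` for all `e` (i.e. `(−t) λ_max(S) ≤ 1`) —
and which carries the scale-invariant gradient bound, is zero. Proof idea: `θ = (−t)|curl u|` is a
bounded ancient subsolution of `∂_t − Δ + u·∇` (Kato); its supremum is attained on a renormalised
limit in the compact class; strong maximum principle forces `|ω| = M/(−t)`, `∇ξ = 0`, hence `M = 0`. -/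
def StretchingWallLiouville : Prop :=
  ∀ (C : ℝ) (u : ℝ → ℝ³ → ℝ³), InClassA C u →
    (∃ C₁ : ℝ, ∀ t < 0, ∀ x, ‖fderiv ℝ (u t) x‖ ≤ C₁ / (-t)) →
    (∀ t < 0, ∀ x, ∀ e : ℝ³, (-t) * ⟪fderiv ℝ (u t) x e, e⟫_ℝ ≤ ‖e‖ ^ 2) →
    ∀ t < 0, ∀ x, u t x = 0

/-- FIRST LEMMA (certificate form, the lever's first non-pointwise rung): there is an explicit
similarity radius `R = R(ε, C, C₁)` such that sub-critical ALIGNED stretching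
`(−t)(⟪S ξ, ξ⟫ − |∇ξ|²) ≤ 1 − ε` inside the backward paraboloid `‖x‖ ≤ R √(−t)` alone forces
`u ≡ 0` (Gaussian supersolution `h = exp(α|y|²)` of the stretching operator in similarity
variables; outside the paraboloid the bounded stretching is absorbed by the Ornstein–Uhlenbeck
confinement). `ξ = vorticityDirection (curl u)`. -/
def StretchingCertificateLiouville : Prop :=
  ∀ (ε C C₁ : ℝ), 0 < ε → ∃ R : ℝ, 0 < R ∧
    ∀ (u : ℝ → ℝ³ → ℝ³), InClassA C u →
      (∀ t < 0, ∀ x, ‖fderiv ℝ (u t) x‖ ≤ C₁ / (-t)) →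
      (∀ t < 0, ∀ x, ‖x‖ ≤ R * Real.sqrt (-t) → curl (u t) x ≠ 0 →
        (-t) * (⟪fderiv ℝ (u t) x (vorticityDirection (curl (u t)) x),
                  vorticityDirection (curl (u t)) x⟫_ℝ
               - frobeniusNormSq (fderiv ℝ (vorticityDirection (curl (u t))) x)) ≤ 1 - ε) →
      ∀ t < 0, ∀ x, u t x = 0

/-! ## Card `backward-profile-symmetrisation` -/

/-- FIRST LEMMA (perturbative Liouville at `t = −∞`, known type: Kato/Koch–Tataru small-norm
uniqueness in the scale-invariant sup norm on `(−∞, T]` + forward uniqueness of bounded mild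
solutions): an element of `𝒜_C` whose scale-invariant amplitude `√(−t)‖u(t,·)‖_∞` tends to `0`
as `t → −∞` vanishes identically. -/
def BackwardSmallnessLiouville : Prop :=
  ∀ (C : ℝ) (u : ℝ → ℝ³ → ℝ³), InClassA C u →
    (∀ ε > 0, ∃ T < 0, ∀ t ≤ T, ∀ x, Real.sqrt (-t) * ‖u t x‖ ≤ ε) →
    ∀ t < 0, ∀ x, u t x = 0

/-- FIRST LEMMA (the card's theorem; new as far as searched): a KNSS-mild ancient solution with
Type-I temporal decay that is PERIODIC IN ONE SPATIAL DIRECTION is identically zero. Proof line: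
recentred zoom-out limits at `t = −∞` ("backward profiles") inherit invariance under ALL
translations along `e` (the period shrinks to `0`), hence are 2.5-D Type-I ancient, hence `0`;
so the scale-invariant amplitude tends to `0` backward, and `BackwardSmallnessLiouville` ends it. -/
def PeriodicTypeIAncientLiouville : Prop :=
  ∀ (C L : ℝ) (e : ℝ³) (u : ℝ → ℝ³ → ℝ³), InClassA C u → e ≠ 0 → 0 < L →
    (∀ t < 0, ∀ x, u t (x + L • e) = u t x) →
    ∀ t < 0, ∀ x, u t x = 0

/-- The 2.5-D leaf used by the card (elementary with Type-I decay: the planar vorticity is a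
bounded ancient solution of a drift–heat equation WITHOUT stretching and decays like `C₁/(−t)`;
alternatively KNSS2009 Thm 5.1 = fact `KNSS2009_liouville_planar`): an element of `𝒜_C`
invariant under all translations along a direction `e ≠ 0` vanishes. -/
def TranslationInvariantLeaf : Prop :=
  ∀ (C : ℝ) (e : ℝ³) (u : ℝ → ℝ³ → ℝ³), InClassA C u → e ≠ 0 →
    (∀ θ : ℝ, ∀ t < 0, ∀ x, u t (x + θ • e) = u t x) →
    ∀ t < 0, ∀ x, u t x = 0

end Summit.NavierStokesRegularity.NavierStokesRegularity.Cruxes.LinearLiouvilleSeven.Ideator1
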